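import Mathlib.Analysis.SpecialFunctions.Trigonometric.Bounds
import Mathlib.Topology.MetricSpace.Sequences
import Literature.Analysis.FluidPDE.AxisymmetricVorticityTransport
import Summits.NavierStokesRegularity.NavierStokesRegularity.Theorems.L3TimeExponentPincerTranslationInvariantLimit
import HarnessLib.Audit
import HarnessLib

/-!
# L3TimeExponentPincer — the receding-axis lemma: weak limits of fields axisymmetric about receding axes vanish

Support kernel for the crux `L3CascadeJaw` (item stmt-NavierStokesRegularity-19499) of route
`L3TimeExponentPincer`; planner nsreg-p2 ROUND-12 §2b / §Seeds (s2): the (J)-step of the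
compactness reduction `CritSmoothingNoSwirlB ⇐ (SFL³)` zooms swirl-free axisymmetric solutions at
points `x_k` with `cylRadius x_k / λ_k → ∞`; the rescaled fields `λ_k u_k (x_k + λ_k ·)` are
axisymmetric about the vertical axis through `-x_k^h/λ_k`, which recedes, and this file shows that
their weak limit is then `0`.

**Receding-axis lemma.** Let `v_k : ℝ³ → ℝ³` be locally integrable vector fields with locally
uniform `L¹` bounds (e.g. a bounded sequence in `L^p`, see
`…TranslationInvariantLimit.exists_setIntegral_norm_le_of_eLpNorm_le`), each axisymmetric about
the vertical axis `a_k + ℝ e_z` — `v_k (a_k + R_θ (x - a_k)) = R_θ (v_k x)` for all angles `θ`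
(`rotZ`) — and suppose the axes recede: `cylRadius a_k → ∞`. If `v_k → v` in the sense of
distributions (against every `g ∈ C_c^∞(ℝ³; ℝ)`) and `v ∈ L^p`, `1 ≤ p < ∞`, then `v = 0` a.e.
(`ae_eq_zero_of_tendsto_of_isAxisymmetricAbout_receding`); the same for scalar fields invariant
under the rotations (`ae_eq_zero_of_tendsto_of_isAxisymmetricScalarAbout_receding`).

*Proof.* Along a subsequence the horizontal unit directions `n_k = a_k^h/|a_k^h|` converge to a
unit vector `n`; the rotation by the angle `θ_k = 1/cylRadius a_k` about the `k`-th axis is a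
measure-preserving isometry of `ℝ³` which converges, uniformly on bounded sets, to the translation
by the horizontal unit vector `c = (n₁, -n₀, 0)` (`exists_subseq_rotation_tendsto_translation`:
`a - R_θ a = (1 - cos θ) a^h + sin θ (a₁, -a₀, 0)` with `d (1 - cos (1/d)) → 0`, `d sin (1/d) → 1`,
and `‖R_θ z - z‖ ≤ |θ| ‖z‖`), while the linear parts `R_{θ_k} → 1` in operator norm
(`opNorm_rotZL_sub_one_le`). By `…TranslationInvariantLimit.ae_comp_add_eq_self_of_tendsto_integral_smul`
the limit is invariant under the translation by `c ≠ 0`, hence zero by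
`…TranslationInvariantLimit.ae_eq_zero_of_memLp_of_comp_add_ae_eq`.

This is the device of Koch–Nadirashvili–Seregin–Šverák, *Liouville theorems for the Navier–Stokes
equations and applications*, Acta Math. 203 (2009) 83–105 = arXiv:0709.3599, proof of Thm. 6.2
(arXiv p. 13: «since the solutions `v^(k)` are axi-symmetric and `M_k ↗ ∞`, it is easy to see that
`w` is independent of the `x₂`-variable»), stated for weak (distributional) rather than locally
uniform limits.  WHAT THIS IS NOT: not NS regularity or blow-up; nothing here uses the
Navier–Stokes equations; the crux `L3CascadeJaw` is untouched; no crux claim.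
-/

noncomputable section

open MeasureTheory Set Function Filter Topology Metric WithLp
open scoped ENNReal NNReal ContDiff

namespace Summit.NavierStokesRegularity.NavierStokesRegularity.Theorems.L3TimeExponentPincerRecedingAxis

open Literature.Analysis.FluidPDE
open Summit.NavierStokesRegularity.NavierStokesRegularity.Theorems.L3TimeExponentPincerTranslationInvariantLimit

/-! ### Geometry of the rotations `rotZ` -/

/-- The rotation by `θ` moves a vector by at most `|θ|` times its length:
`‖R_θ z - z‖ ≤ |θ| ‖z‖` (`‖R_θ z - z‖² = (2 - 2 cos θ)(z₀² + z₁²) ≤ θ² ‖z‖²`). -/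
theorem norm_rotZ_sub_self_le (θ : ℝ) (z : EuclideanSpace ℝ (Fin 3)) :
    ‖rotZ θ z - z‖ ≤ |θ| * ‖z‖ := by
  have hcos : 2 - 2 * Real.cos θ ≤ θ ^ 2 := by
    linarith [Real.one_sub_sq_div_two_le_cos (x := θ)]
  rw [EuclideanSpace.norm_eq, EuclideanSpace.norm_eq, ← Real.sqrt_sq (abs_nonneg θ),
    ← Real.sqrt_mul (sq_nonneg _)]
  apply Real.sqrt_le_sqrt
  simp only [Fin.sum_univ_three, PiLp.sub_apply, rotZ_apply_zero, rotZ_apply_one, rotZ_apply_two,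
    Real.norm_eq_abs, sq_abs, sub_self]
  have hid : (Real.cos θ * z 0 - Real.sin θ * z 1 - z 0) ^ 2
      + (Real.sin θ * z 0 + Real.cos θ * z 1 - z 1) ^ 2
      = (2 - 2 * Real.cos θ) * (z 0 ^ 2 + z 1 ^ 2) := by
    linear_combination (z 0 ^ 2 + z 1 ^ 2) * Real.sin_sq_add_cos_sq θ
  rw [hid]
  nlinarith [mul_le_mul_of_nonneg_right hcos (add_nonneg (sq_nonneg (z 0)) (sq_nonneg (z 1))),
    mul_nonneg (sq_nonneg θ) (sq_nonneg (z 2))]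

/-- Operator-norm form: `‖R_θ - 1‖ ≤ |θ|`. -/
theorem opNorm_rotZL_sub_one_le (θ : ℝ) :
    ‖rotZL θ - 1‖ ≤ |θ| := by
  refine ContinuousLinearMap.opNorm_le_bound _ (abs_nonneg θ) fun z => ?_
  simpa using norm_rotZ_sub_self_le θ z

/-- `R_θ → 1` in operator norm as `θ → 0`. -/
theorem tendsto_rotZL_one {θ : ℕ → ℝ} (hθ : Tendsto θ atTop (𝓝 0)) :
    Tendsto (fun k => rotZL (θ k)) atTop (𝓝 1) := by
  rw [tendsto_iff_norm_sub_tendsto_zero]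
  refine squeeze_zero (fun k => norm_nonneg _) (fun k => opNorm_rotZL_sub_one_le (θ k)) ?_
  simpa using hθ.abs

/-- The displacement of a point under the rotation about the origin, in terms of its horizontal
part `a^h = (a₀, a₁, 0)` and the perpendicular horizontal vector `(a₁, -a₀, 0)`:
`a - R_θ a = (1 - cos θ) a^h + sin θ (a₁, -a₀, 0)`. -/
theorem self_sub_rotZ_eq (θ : ℝ) (a : EuclideanSpace ℝ (Fin 3)) :
    a - rotZ θ a = (1 - Real.cos θ) • toLp 2 ![a 0, a 1, 0] + Real.sin θ • toLp 2 ![a 1, -a 0, 0] := by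
  ext i
  fin_cases i <;> simp <;> ring

/-- The horizontal part has length `cylRadius`: `‖(a₀, a₁, 0)‖ = cylRadius a`. -/
theorem norm_horizontal_eq_cylRadius (a : EuclideanSpace ℝ (Fin 3)) :
    ‖toLp 2 ![a 0, a 1, 0]‖ = cylRadius a := by
  rw [EuclideanSpace.norm_eq, cylRadius]
  congr 1
  simp [Fin.sum_univ_three]

/-- The perpendicular horizontal vector has length `cylRadius`: `‖(a₁, -a₀, 0)‖ = cylRadius a`.
-/
theorem norm_perp_eq_cylRadius (a : EuclideanSpace ℝ (Fin 3)) :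
    ‖toLp 2 ![a 1, -a 0, 0]‖ = cylRadius a := by
  rw [EuclideanSpace.norm_eq, cylRadius]
  congr 1
  simp [Fin.sum_univ_three]
  ring

/-- The rotation by `θ` about the vertical axis through `a`, `x ↦ a + R_θ (x - a)`, is an isometry
of `ℝ³`. -/
theorem isometry_rotZ_about (a : EuclideanSpace ℝ (Fin 3)) (θ : ℝ) :
    Isometry (fun x : EuclideanSpace ℝ (Fin 3) => a + rotZ θ (x - a)) := by
  refine Isometry.of_dist_eq fun x y => ?_
  rw [dist_eq_norm, dist_eq_norm, add_sub_add_left_eq_sub, ← rotZL_apply, ← rotZL_apply,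
    ← map_sub, rotZL_apply, norm_rotZ, sub_sub_sub_cancel_right]

/-- The rotation about the vertical axis through `a` preserves Lebesgue measure. -/
theorem measurePreserving_rotZ_about (a : EuclideanSpace ℝ (Fin 3)) (θ : ℝ) :
    MeasurePreserving (fun x : EuclideanSpace ℝ (Fin 3) => a + rotZ θ (x - a)) volume volume := by
  have h : (fun x : EuclideanSpace ℝ (Fin 3) => a + rotZ θ (x - a))
      = (fun y => a + y) ∘ (rotZLIE θ) ∘ (fun x => x - a) := rfl
  rw [h]
  exact ((measurePreserving_add_left volume a).comp (rotZLIE θ).measurePreserving).comp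
    (measurePreserving_sub_right volume a)

/-! ### Two elementary limits: `d sin (1/d) → 1`, `d (1 - cos (1/d)) → 0` -/

/-- `|d sin (1/d) - 1| ≤ 1/d` for `d ≥ 1` (from `x - x³/6 < sin x < x`). -/
theorem abs_mul_sin_inv_sub_one_le {d : ℝ} (hd : 1 ≤ d) :
    |d * Real.sin d⁻¹ - 1| ≤ d⁻¹ := by
  have hd0 : 0 < d := lt_of_lt_of_le zero_lt_one hd
  have hx : 0 < d⁻¹ := inv_pos.2 hd0
  have h1 : Real.sin d⁻¹ < d⁻¹ := Real.sin_lt hx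
  have h2 : d⁻¹ - d⁻¹ ^ 3 / 6 < Real.sin d⁻¹ := Real.sin_gt_sub_cube hx
  have h3 : d * d⁻¹ = 1 := mul_inv_cancel₀ hd0.ne'
  rw [abs_le]
  constructor
  · -- `-d⁻¹ ≤ d sin d⁻¹ - 1`
    have h4 : d * (d⁻¹ - d⁻¹ ^ 3 / 6) ≤ d * Real.sin d⁻¹ := mul_le_mul_of_nonneg_left h2.le hd0.le
    have h5 : d * (d⁻¹ - d⁻¹ ^ 3 / 6) = 1 - d⁻¹ * d⁻¹ / 6 := by
      field_simp
    have h6 : d⁻¹ * d⁻¹ ≤ d⁻¹ := by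
      have : d⁻¹ ≤ 1 := inv_le_one_of_one_le₀ hd
      nlinarith
    nlinarith
  · have h4 : d * Real.sin d⁻¹ ≤ d * d⁻¹ := mul_le_mul_of_nonneg_left h1.le hd0.le
    nlinarith

/-- `0 ≤ d (1 - cos (1/d)) ≤ 1/d` for `d > 0` (from `1 - x²/2 ≤ cos x ≤ 1`). -/
theorem mul_one_sub_cos_inv_mem {d : ℝ} (hd : 0 < d) :
    0 ≤ d * (1 - Real.cos d⁻¹) ∧ d * (1 - Real.cos d⁻¹) ≤ d⁻¹ := by
  refine ⟨mul_nonneg hd.le (sub_nonneg.2 (Real.cos_le_one _)), ?_⟩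
  have h1 : 1 - d⁻¹ ^ 2 / 2 ≤ Real.cos d⁻¹ := Real.one_sub_sq_div_two_le_cos
  have h2 : d * (1 - Real.cos d⁻¹) ≤ d * (d⁻¹ ^ 2 / 2) :=
    mul_le_mul_of_nonneg_left (by linarith) hd.le
  have h3 : d * (d⁻¹ ^ 2 / 2) = d⁻¹ / 2 := by field_simp
  have h4 : 0 ≤ d⁻¹ := inv_nonneg.2 hd.le
  linarith

/-! ### Rotations about receding axes converge to a translation -/

/-- **Rotations about receding vertical axes converge to a horizontal translation.**  If
`cylRadius a_k → ∞`, then along a subsequence `φ` there are angles `θ_k → 0` and a horizontal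
vector `c ≠ 0` (in fact `|c| = 1`) such that the rotations `x ↦ a_{φ k} + R_{θ_k} (x - a_{φ k})`
converge to the translation `x ↦ x + c` uniformly on bounded sets.  (Take `θ_k = 1/cylRadius a_{φ k}`
and `φ` along which the horizontal unit directions of `a_k` converge to `n`; then
`c = (n₁, -n₀, 0)`.) -/
theorem exists_subseq_rotation_tendsto_translation {a : ℕ → EuclideanSpace ℝ (Fin 3)}
    (ha : Tendsto (fun k => cylRadius (a k)) atTop atTop) :
    ∃ (φ : ℕ → ℕ) (θ : ℕ → ℝ) (c : EuclideanSpace ℝ (Fin 3)), StrictMono φ ∧ c ≠ 0 ∧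
      Tendsto θ atTop (𝓝 0) ∧
      ∀ R ε : ℝ, 0 < ε → ∀ᶠ k in atTop, ∀ z ∈ closedBall (0 : EuclideanSpace ℝ (Fin 3)) R,
        ‖(a (φ k) + rotZ (θ k) (z - a (φ k))) - (z + c)‖ ≤ ε := by
  -- horizontal unit directions and a convergent subsequence
  set d : ℕ → ℝ := fun k => cylRadius (a k) with hd
  set nh : ℕ → EuclideanSpace ℝ (Fin 3) := fun k => (d k)⁻¹ • toLp 2 ![a k 0, a k 1, 0] with hnh
  set pn : ℕ → EuclideanSpace ℝ (Fin 3) := fun k => (d k)⁻¹ • toLp 2 ![a k 1, -a k 0, 0] with hpn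
  have hnh_le : ∀ k, nh k ∈ closedBall (0 : EuclideanSpace ℝ (Fin 3)) 1 := by
    intro k
    rw [mem_closedBall_zero_iff, hnh]
    dsimp only
    rw [norm_smul, norm_inv, Real.norm_of_nonneg (cylRadius_nonneg _),
      norm_horizontal_eq_cylRadius]
    exact inv_mul_le_one
  obtain ⟨n, -, φ, hφ, hφn⟩ := tendsto_subseq_of_bounded isBounded_closedBall hnh_le
  have hdφ : Tendsto (fun k => d (φ k)) atTop atTop := ha.comp hφ.tendsto_atTop
  have hd1 : ∀ᶠ k in atTop, 1 ≤ d (φ k) := hdφ.eventually_ge_atTop 1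
  -- the limit direction is a horizontal unit vector
  have hn2 : n 2 = 0 := by
    have h1 : Tendsto (fun k => nh (φ k) 2) atTop (𝓝 (n 2)) :=
      ((EuclideanSpace.proj (2 : Fin 3)).continuous.tendsto n).comp hφn
    have h2 : (fun k => nh (φ k) 2) = fun _ => 0 := by
      funext k; simp [hnh]
    rw [h2] at h1
    exact (tendsto_nhds_unique h1 tendsto_const_nhds)
  have hn1 : ‖n‖ = 1 := by
    have h1 : Tendsto (fun k => ‖nh (φ k)‖) atTop (𝓝 ‖n‖) := hφn.norm
    have h2 : ∀ᶠ k in atTop, ‖nh (φ k)‖ = 1 := by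
      filter_upwards [hd1] with k hk
      rw [hnh]
      dsimp only
      rw [norm_smul, norm_inv, Real.norm_of_nonneg (cylRadius_nonneg _),
        norm_horizontal_eq_cylRadius]
      exact inv_mul_cancel₀ (by change 1 ≤ cylRadius (a (φ k)) at hk; linarith)
    exact tendsto_nhds_unique h1 (tendsto_const_nhds.congr' (h2.mono fun k hk => hk.symm))
  -- the limit translation vector
  set c : EuclideanSpace ℝ (Fin 3) := toLp 2 ![n 1, -n 0, 0] with hc
  have hcn : ‖c‖ = 1 := by
    rw [← hn1, EuclideanSpace.norm_eq, EuclideanSpace.norm_eq]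
    congr 1
    simp [Fin.sum_univ_three, hc, hn2]
    ring
  have hc0 : c ≠ 0 := by
    rw [← norm_ne_zero_iff, hcn]; exact one_ne_zero
  -- `pn (φ k) → c` (a continuous linear image of `nh (φ k) → n`)
  have hpn_c : Tendsto (fun k => pn (φ k)) atTop (𝓝 c) := by
    -- the map `x ↦ (x₁, -x₀, 0)` is continuous and sends `nh k` to `pn k`, `n` to `c`
    let L : EuclideanSpace ℝ (Fin 3) → EuclideanSpace ℝ (Fin 3) := fun x => toLp 2 ![x 1, -x 0, 0]
    have hL : Continuous L := by
      apply (PiLp.continuous_toLp 2 _).comp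
      refine continuous_pi fun i => ?_
      fin_cases i
      · exact (EuclideanSpace.proj (1 : Fin 3)).continuous
      · exact (EuclideanSpace.proj (0 : Fin 3)).continuous.neg
      · exact continuous_const
    have hLn : ∀ k, L (nh k) = pn k := by
      intro k
      ext i
      fin_cases i <;> simp [L, hnh, hpn]
    have hLc : L n = c := rfl
    have h := (hL.tendsto n).comp hφn
    rw [hLc] at h
    refine h.congr fun k => ?_
    simp only [Function.comp_apply, hLn]
  -- angles
  set θ : ℕ → ℝ := fun k => (d (φ k))⁻¹ with hθ
  have hθ0 : Tendsto θ atTop (𝓝 0) := tendsto_inv_atTop_zero.comp hdφ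
  -- the displacement of the axis point converges to `c`
  have hw : Tendsto (fun k => a (φ k) - rotZ (θ k) (a (φ k))) atTop (𝓝 c) := by
    have hdec : ∀ᶠ k in atTop, a (φ k) - rotZ (θ k) (a (φ k))
        = ((1 - Real.cos (θ k)) * d (φ k)) • nh (φ k) + (Real.sin (θ k) * d (φ k)) • pn (φ k) := by
      filter_upwards [hd1] with k hk
      have hdk : d (φ k) ≠ 0 := by linarith
      rw [self_sub_rotZ_eq, hnh, hpn]
      dsimp only
      rw [smul_smul, smul_smul, mul_assoc, mul_inv_cancel₀ hdk, mul_one, mul_assoc,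
        mul_inv_cancel₀ hdk, mul_one]
    have hA : Tendsto (fun k => ((1 - Real.cos (θ k)) * d (φ k)) • nh (φ k)) atTop (𝓝 0) := by
      apply squeeze_zero_norm' _ hθ0
      filter_upwards [hd1] with k hk
      have hdk : 0 < d (φ k) := by linarith
      rw [norm_smul, Real.norm_of_nonneg (mul_nonneg (sub_nonneg.2 (Real.cos_le_one _)) hdk.le)]
      calc (1 - Real.cos (θ k)) * d (φ k) * ‖nh (φ k)‖
          ≤ (1 - Real.cos (θ k)) * d (φ k) * 1 := by
            gcongr
            · exact mul_nonneg (sub_nonneg.2 (Real.cos_le_one _)) hdk.le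
            · exact mem_closedBall_zero_iff.1 (hnh_le (φ k))
        _ ≤ θ k := by
            rw [mul_one, mul_comm]
            exact (mul_one_sub_cos_inv_mem hdk).2
    have hB : Tendsto (fun k => (Real.sin (θ k) * d (φ k)) • pn (φ k)) atTop (𝓝 c) := by
      have hs : Tendsto (fun k => Real.sin (θ k) * d (φ k)) atTop (𝓝 1) := by
        rw [tendsto_iff_norm_sub_tendsto_zero]
        refine squeeze_zero' (Eventually.of_forall fun k => norm_nonneg _) ?_ hθ0
        filter_upwards [hd1] with k hk
        rw [Real.norm_eq_abs, mul_comm]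
        exact abs_mul_sin_inv_sub_one_le hk
      simpa using hs.smul hpn_c
    rw [← zero_add c]
    exact (hA.add hB).congr' (hdec.mono fun k hk => hk.symm)
  refine ⟨φ, θ, c, hφ, hc0, hθ0, fun R ε hε => ?_⟩
  -- uniform convergence on `closedBall 0 R`
  have h1 : ∀ᶠ k in atTop, |θ k| * R ≤ ε / 2 := by
    have : Tendsto (fun k => |θ k| * R) atTop (𝓝 0) := by
      simpa using hθ0.abs.mul_const R
    exact (this.eventually (ge_mem_nhds (by positivity : (0 : ℝ) < ε / 2))).mono fun k hk => hk
  have h2 : ∀ᶠ k in atTop, ‖(a (φ k) - rotZ (θ k) (a (φ k))) - c‖ ≤ ε / 2 := by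
    have := (tendsto_iff_norm_sub_tendsto_zero.1 hw).eventually
      (ge_mem_nhds (by positivity : (0 : ℝ) < ε / 2))
    exact this.mono fun k hk => hk
  filter_upwards [h1, h2] with k hk1 hk2 z hz
  have hzR : ‖z‖ ≤ R := mem_closedBall_zero_iff.1 hz
  have hsplit : (a (φ k) + rotZ (θ k) (z - a (φ k))) - (z + c)
      = (rotZ (θ k) z - z) + ((a (φ k) - rotZ (θ k) (a (φ k))) - c) := by
    rw [← rotZL_apply, map_sub, rotZL_apply, rotZL_apply]
    abel
  rw [hsplit]
  calc ‖(rotZ (θ k) z - z) + ((a (φ k) - rotZ (θ k) (a (φ k))) - c)‖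
      ≤ ‖rotZ (θ k) z - z‖ + ‖(a (φ k) - rotZ (θ k) (a (φ k))) - c‖ := norm_add_le _ _
    _ ≤ |θ k| * ‖z‖ + ε / 2 := add_le_add (norm_rotZ_sub_self_le _ _) hk2
    _ ≤ |θ k| * R + ε / 2 := by gcongr
    _ ≤ ε / 2 + ε / 2 := by gcongr
    _ = ε := by ring

/-! ### The receding-axis lemma -/

/-- **Receding-axis lemma (vector fields).**  Let `v_k : ℝ³ → ℝ³` be locally integrable, with
locally uniform `L¹` bounds, axisymmetric about the vertical axes `a_k + ℝ e_z`
(`v_k (a_k + R_θ (x - a_k)) = R_θ (v_k x)`), with `cylRadius a_k → ∞`, and `v_k → v` against every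
test function `g ∈ C_c^∞(ℝ³; ℝ)`.  If `v ∈ L^p`, `1 ≤ p < ∞`, then `v = 0` a.e.  (KNSS 2009, proof
of Thm. 6.2, arXiv:0709.3599 p. 13, in weak form.) -/
theorem ae_eq_zero_of_tendsto_of_isAxisymmetricAbout_receding {p : ℝ≥0∞} (hp1 : 1 ≤ p) (hp : p ≠ ⊤)
    {v : ℕ → EuclideanSpace ℝ (Fin 3) → EuclideanSpace ℝ (Fin 3)}
    {vl : EuclideanSpace ℝ (Fin 3) → EuclideanSpace ℝ (Fin 3)} {a : ℕ → EuclideanSpace ℝ (Fin 3)}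
    (hax : ∀ k (θ : ℝ) x, v k (a k + rotZ θ (x - a k)) = rotZ θ (v k x))
    (ha : Tendsto (fun k => cylRadius (a k)) atTop atTop)
    (hv : ∀ k, LocallyIntegrable (v k) volume)
    (hbd : ∀ R : ℝ, ∃ C : ℝ, ∀ k,
      ∫ x in closedBall (0 : EuclideanSpace ℝ (Fin 3)) R, ‖v k x‖ ≤ C)
    (hvl : MemLp vl p volume)
    (hconv : ∀ g : EuclideanSpace ℝ (Fin 3) → ℝ, ContDiff ℝ ∞ g → HasCompactSupport g →
      Tendsto (fun k => ∫ x, g x • v k x) atTop (𝓝 (∫ x, g x • vl x))) :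
    vl =ᵐ[volume] 0 := by
  obtain ⟨φ, θ, c, hφ, hc0, hθ0, hT⟩ := exists_subseq_rotation_tendsto_translation ha
  refine ae_eq_zero_of_memLp_of_comp_add_ae_eq hp1 hp hvl hc0 ?_
  refine ae_comp_add_eq_self_of_tendsto_integral_smul
    (f := fun k => v (φ k)) (T := fun k x => a (φ k) + rotZ (θ k) (x - a (φ k)))
    (M := fun k => rotZL (θ k))
    (fun k => measurePreserving_rotZ_about _ _) (fun k => isometry_rotZ_about _ _) hT
    (tendsto_rotZL_one hθ0) (fun k => Eventually.of_forall fun x => ?_) (fun k => hv (φ k))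
    (fun R => ?_) (hvl.locallyIntegrable hp1) (fun g hg hgs => (hconv g hg hgs).comp hφ.tendsto_atTop)
  · simp only [rotZL_apply, hax]
  · obtain ⟨C, hC⟩ := hbd R
    exact ⟨C, fun k => hC (φ k)⟩

/-- **Receding-axis lemma (scalar fields).**  Let `q_k : ℝ³ → ℝ` be locally integrable, with
locally uniform `L¹` bounds, invariant under the rotations about the vertical axes `a_k + ℝ e_z`
(`q_k (a_k + R_θ (x - a_k)) = q_k x`), with `cylRadius a_k → ∞`, and `q_k → q` against every test
function `g ∈ C_c^∞(ℝ³; ℝ)`.  If `q ∈ L^p`, `1 ≤ p < ∞`, then `q = 0` a.e. -/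
theorem ae_eq_zero_of_tendsto_of_isAxisymmetricScalarAbout_receding {p : ℝ≥0∞} (hp1 : 1 ≤ p)
    (hp : p ≠ ⊤) {q : ℕ → EuclideanSpace ℝ (Fin 3) → ℝ} {ql : EuclideanSpace ℝ (Fin 3) → ℝ}
    {a : ℕ → EuclideanSpace ℝ (Fin 3)}
    (hax : ∀ k (θ : ℝ) x, q k (a k + rotZ θ (x - a k)) = q k x)
    (ha : Tendsto (fun k => cylRadius (a k)) atTop atTop)
    (hq : ∀ k, LocallyIntegrable (q k) volume)
    (hbd : ∀ R : ℝ, ∃ C : ℝ, ∀ k,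
      ∫ x in closedBall (0 : EuclideanSpace ℝ (Fin 3)) R, ‖q k x‖ ≤ C)
    (hql : MemLp ql p volume)
    (hconv : ∀ g : EuclideanSpace ℝ (Fin 3) → ℝ, ContDiff ℝ ∞ g → HasCompactSupport g →
      Tendsto (fun k => ∫ x, g x * q k x) atTop (𝓝 (∫ x, g x * ql x))) :
    ql =ᵐ[volume] 0 := by
  obtain ⟨φ, θ, c, hφ, hc0, -, hT⟩ := exists_subseq_rotation_tendsto_translation ha
  refine ae_eq_zero_of_memLp_of_comp_add_ae_eq hp1 hp hql hc0 ?_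
  refine ae_comp_add_eq_self_of_tendsto_integral_smul
    (f := fun k => q (φ k)) (T := fun k x => a (φ k) + rotZ (θ k) (x - a (φ k)))
    (M := fun _ => (1 : ℝ →L[ℝ] ℝ))
    (fun k => measurePreserving_rotZ_about _ _) (fun k => isometry_rotZ_about _ _) hT
    tendsto_const_nhds (fun k => Eventually.of_forall fun x => ?_) (fun k => hq (φ k))
    (fun R => ?_) (hql.locallyIntegrable hp1) (fun g hg hgs => ?_)
  · show q (φ k) (a (φ k) + rotZ (θ k) (x - a (φ k))) = (1 : ℝ →L[ℝ] ℝ) (q (φ k) x)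
    rw [hax]
    rfl
  · obtain ⟨C, hC⟩ := hbd R
    exact ⟨C, fun k => hC (φ k)⟩
  · simpa only [smul_eq_mul, Function.comp_def] using (hconv g hg hgs).comp hφ.tendsto_atTop

end Summit.NavierStokesRegularity.NavierStokesRegularity.Theorems.L3TimeExponentPincerRecedingAxis

end
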